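import Summits.KontsevichZagierPeriods.KontsevichZagierPeriods.Theorems.KzOnePeriodsE1XiImg2

/-!
# KontsevichZagierPeriods — kz1p third kind on the pole chart, part 5: the λ-rows over the real loops

Cell pub-kz1p, seat b2b-kz1p-2, gen 23 (kz1p v2.7, shape (Λ); PROCEDURE.md §4k; LEAN-IN-TREE rule).  Pure
mathematics over the tree's formal period space `Literature.NumberTheory.Transcendental.CurvePeriods`
([cite: HuberWustholz2022, §13.1 (p. 120), Thm 13.3 (2) (p. 121)]); no named facts, no `sorry`; notations local.

kz1p's third-kind CYCLE symbols `XI:P:eps_j = ξ_P(ε_j) = ∮_{ε_j} (y + y_P)/(x − x_P) · dx/y` (class E1; `ε₁` the real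
oval of `E(ℝ)` over the 2-torsion interval `[e₁, e₂]`, `ε₂ = [i]_* ε₁` on the CM curves `y² = x³ + ax`, certificate
field `cycles`) are the tree symbols `(E^w(x_P), ξ_P, ε_j^w)` over LOOPS on the pole charts (parts 1–4 realise the
PATH symbols `ξ_P(g)`).  kz1p's certificate rows **`LAM-P-Q-1`**: `ξ_P(ε₂) + ξ_Q(ε₁) = 0` and **`LAM-P-Q-2`**:
`−ξ_P(ε₁) + ξ_Q(ε₂) = 0` (`Q = [i]P`; tests E1-16, E1-21, E1-22; kz1p's "λ-rules of CM-unit origin", stated by kz1p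
through the Legendre-type evaluation `ξ_P(ε_j) = 2λ(u_P, ω_j)` [cite: HuberWustholz2022, §18.1 (pp. 171–173)]) are,
as RELATIONS, the rules `IMG2` and `IMG` of parts 2 and 4 over closed paths: `LAM-…-2` is (R4)+(R1) along `[i]^w`
(`corpus_xi_cmI`, part 2, verbatim), and `LAM-…-1` is part 4's `xi_img2_derivation` with a CLOSED real abscissa
(`r(0) = r(1)`, so `w = 1`) followed by (R3): the logarithm symbol `ℓ(log 1) = ℓ(0)` is carried by the constant path
`(1, 1)` of `𝔾ₘ`, a boundary.  This file supplies exactly that: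

* `span_logSym_one` — `ℓ(log 1) ∈ ⟨(R1)–(R5)⟩_ℚ̄` ((R3), [cite: HuberWustholz2022, §13.1 (A) (p. 120)]);
* `xi_img2_loop_derivation` — `(E^w(−x₀), ξ_{(−x₀,y₀)}, γ) + (E^w(x₀), ξ_{(x₀,y₁)}, β) ∈ ⟨(R1)–(R5)⟩_ℚ̄` and
  `∫_γ ξ_{(−x₀,y₀)} + ∫_β ξ_{(x₀,y₁)} = 0` whenever `γ = [d]^w β` on `[0, 1]` (`d² = −1`, `y₀ + d·y₁ = 0`) and the
  `x`-coordinate of `γ` is real `> −x₀` on `[0, 1]` with `r(0) = r(1)`; `corpus_xi_loops` — the corpus form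
  (`a ∈ {−1, −25, −1156, −36}`, `d = −i`);
* `exists_realOval` — the real oval of `E_{A,B}(ℝ)` over `[e₁, e₂]` (`e₁ < e₂ < e₃` the 2-torsion abscissae,
  `e₁ ∈ ℚ̄`) as a closed `C¹` path `(X, Y)` based at `(e₁, 0)`, `X = (e₁+e₂)/2 + (e₁−e₂)/2 · cos 2πt`, upper sheet
  `Y ≥ 0` on `t ≤ ½` (where `x` increases), lower sheet on `t ≥ ½` — a specialisation of the G2S oval
  `G2SDerivation.exists_weierOval` (`σ = 1`, `η = 1`, `ε = −1`); kz1p's cycle `ε₁`.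
-/

noncomputable section

open scoped BigOperators
open MvPolynomial Set Complex Filter Topology
open Literature.NumberTheory.Transcendental Literature.NumberTheory.Transcendental.CurvePeriods
open Summit.KontsevichZagierPeriods.KzOnePeriods.E1Derivation
open Summit.KontsevichZagierPeriods.KzOnePeriods.G2SDerivation

namespace Summit.KontsevichZagierPeriods.KzOnePeriods.XiDerivation

local notation3 "InSpanRel " c:arg => ∃ (k : ℕ) (ρ : Fin k → (PeriodSymbol →₀ ℂ))
  (a : Fin k → ℂ), (∀ l, IsElementaryRelation (ρ l)) ∧ (∀ l, IsAlgebraic ℚ (a l)) ∧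
    c = ∑ l, a l • ρ l

/-- The symbol `(Z, ω, γ)` as an element of the formal period space. -/
local notation3 (prettyPrint := false) "Sy[" Z ", " hZ ", " ω ", " h ", " γ "]" =>
  (Finsupp.single (⟨Z, hZ, ω, h, γ⟩ : PeriodSymbol) (1 : ℂ) : PeriodSymbol →₀ ℂ)

/-- The period `∫_γ ω` of the symbol `(Z, ω, γ)`. -/
local notation3 (prettyPrint := false) "Pe[" Z ", " hZ ", " ω ", " h ", " γ "]" =>
  PeriodSymbol.period (⟨Z, hZ, ω, h, γ⟩ : PeriodSymbol)

/-- The cubic `x³ + Ax + B ∈ ℂ[x, y, w]`. -/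
local notation3 (prettyPrint := false) "fW[" A ", " B "]" =>
  ((X 0 : MvPolynomial (Fin 3) ℂ) ^ 3 + C A * X 0 + C B)

/-- The pole chart `E^w_{A,B}(x₀) = {y² = x³ + Ax + B, (x − x₀)·w = 1} ⊂ 𝔸³`. -/
local notation3 (prettyPrint := false) "EW[" A ", " B ", " x₀ "]" =>
  (⟨3, 2, ![(X 1 : MvPolynomial (Fin 3) ℂ) ^ 2 - fW[A, B], (X 0 - C x₀) * X 2 - 1]⟩ : CurveData)

/-- The projection `pr = (x, y) : E^w → E`. -/
local notation3 (prettyPrint := false) "proj" => (![X 0, X 1] : Fin 2 → MvPolynomial (Fin 3) ℂ)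

/-- **The third-kind form** `ξ_P = (y + y₀)·w · pr^*θ₀` on `E^w_{A,B}(x₀)`, `P = (x₀, y₀)`. -/
local notation3 (prettyPrint := false) "ξ[" A ", " B ", " y₀ "]" =>
  ((((X 1 : MvPolynomial (Fin 3) ℂ) + C y₀) * X 2) • formPullback proj (Weier.theta0 A B))

/-- The multiplicative group `𝔾ₘ = {uv = 1} ⊂ 𝔸²`. -/
local notation3 (prettyPrint := false) "𝔾m" => (⟨2, 1, ![X 0 * X 1 - 1]⟩ : CurveData)

/-- The logarithm symbol `(𝔾ₘ, v du, E)` over a path `E` on `𝔾ₘ`. -/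
local notation3 "logSym " E:arg => (⟨⟨2, 1, ![X 0 * X 1 - 1]⟩, isSmoothAffineCurve_mulGroup,
  ![X 1, 0], hasAlgCoeffs_ydx, E⟩ : PeriodSymbol)

variable {A B x₀ : ℂ}

/-! ### The logarithm symbol `ℓ(log 1)` is a relation -/

/-- **`ℓ(log 1) = ℓ(0) ∈ ⟨(R1)–(R5)⟩_ℚ̄`**: the exponential path `E_{0, log 1} = (e^{t·0}, e^{−t·0})` of the symbol
`ℓ(log 1)` is the constant path `(1, 1)` of `𝔾ₘ`, and a symbol over a constant path is a boundary, (R3)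
[cite: HuberWustholz2022, §13.1 (A) (p. 120)]. -/
theorem span_logSym_one (E : CurvePath 𝔾m)
    (hE : ∀ t, E.toFun t = ![exp ((1 - t) * 0 + t * ((Real.log 1 : ℝ) : ℂ)),
      exp (-((1 - t) * 0 + t * ((Real.log 1 : ℝ) : ℂ)))]) :
    InSpanRel (Finsupp.single (logSym E) (1 : ℂ)) :=
  span_of_rel (isElementaryRelation_single_of_const isSmoothAffineCurve_mulGroup _ hasAlgCoeffs_ydx E
    ![1, 1] fun t _ => by rw [hE t]; simp [Real.log_one])

/-! ### The rule `IMG2` over a loop: kz1p's row `LAM-…-1` -/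

/-- **kz1p's rule `IMG2` over a closed real abscissa (row `LAM-P-Q-1`).**  On `y² = x³ + Ax` (`A ≠ 0`, `x₀ ∈ ℚ̄`,
`d² = −1`, `y₀ + d·y₁ = 0`), let `β` be a path on `E^w(x₀)` and `γ = [d]^w β = (−x∘β, d·y∘β, −w∘β)` on `[0, 1]`
(a path on `E^w(−x₀)`) whose `x`-coordinate is real, `x(γ(t)) = r(t) > −x₀`, with `r(0) = r(1)`.  Then
`(E^w(−x₀), ξ_{(−x₀,y₀)}, γ) + (E^w(x₀), ξ_{(x₀,y₁)}, β) ∈ ⟨(R1)–(R5)⟩_ℚ̄` and `∫_γ ξ_{(−x₀,y₀)} + ∫_β ξ_{(x₀,y₁)} = 0`: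
part 4's `xi_img2_derivation` with `w = 1` ((R4)+(R1) along `[d]^w`, (R1)+(R2) `ξ_Q + ξ_{−Q} ∼ 2 w dx`, (R4) along
`ψ = (x + x₀, w)`, (R5)+(R4) to `ℓ(log 1)`), then (R3) `ℓ(log 1) ∼ 0` (`span_logSym_one`)
[cite: HuberWustholz2022, §13.1 (A), (B) (p. 120), §3.3.1 (pp. 42–43)]. -/
theorem xi_img2_loop_derivation {d : ℂ} (hd : d ^ 2 = -1) (hE : EW[A, 0, x₀].IsSmoothAffineCurve)
    (hE' : EW[A, 0, -x₀].IsSmoothAffineCurve) (hD : Weier.disc A 0 ≠ 0) (hx₀ : IsAlgebraic ℚ x₀)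
    {y₀ y₁ : ℂ} (hy : y₀ + d * y₁ = 0) (hξ₀ : ∀ i, HasAlgCoeffs (ξ[A, 0, y₀] i))
    (hξ₁ : ∀ i, HasAlgCoeffs (ξ[A, 0, y₁] i)) (hξd : ∀ i, HasAlgCoeffs (ξ[A, 0, d * y₁] i))
    {β : CurvePath EW[A, 0, x₀]} {γ : CurvePath EW[A, 0, -x₀]}
    (hγ : ∀ t ∈ Icc (0 : ℝ) 1, γ.toFun t = ![-β.toFun t 0, d * β.toFun t 1, -β.toFun t 2])
    {xr : ℝ} (hxr : x₀ = xr) {r : ℝ → ℝ} (hr : ∀ t ∈ Icc (0 : ℝ) 1, γ.toFun t 0 = (r t : ℂ))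
    (hpos : ∀ t ∈ Icc (0 : ℝ) 1, -xr < r t) (hcl : r 0 = r 1) :
    InSpanRel (Sy[EW[A, 0, -x₀], hE', ξ[A, 0, y₀], hξ₀, γ] + Sy[EW[A, 0, x₀], hE, ξ[A, 0, y₁], hξ₁, β]) ∧
      Pe[EW[A, 0, -x₀], hE', ξ[A, 0, y₀], hξ₀, γ] + Pe[EW[A, 0, x₀], hE, ξ[A, 0, y₁], hξ₁, β] = 0 := by
  -- the exponential path of `ℓ(log 1)` (the constant path `(1, 1)`)
  obtain ⟨E, hEd⟩ := exists_realLogPath (w := (1 : ℝ)) one_pos (by rw [Complex.ofReal_one]; exact isAlgebraic_one)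
  have hw : (1 : ℝ) * (r 0 + xr) = r 1 + xr := by rw [one_mul, hcl]
  have h := xi_img2_derivation hd hE hE' hD hx₀ hy hξ₀ hξ₁ hξd hγ hxr hr hpos hw E hEd
  refine ⟨?_, ?_⟩
  · obtain ⟨k, ρ, a, hρ, ha, hsum⟩ :=
      span_add h.1 (span_smul Ell.isAlgebraic_two (span_logSym_one E hEd))
    exact ⟨k, ρ, a, hρ, ha, by rw [← hsum, sub_add_cancel]⟩
  · have h2 := h.2
    rw [Real.log_one, Complex.ofReal_zero, mul_zero, sub_zero] at h2
    exact h2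

/-- **Third kind, rule `IMG2` over loops on the corpus curves** (tests E1-16, E1-21, E1-22; kz1p row `LAM-P-Q-1`:
`ξ_P(ε₂) + ξ_Q(ε₁) = 0`, `Q = [i]P`, `ε₂ = [i]ε₁`): on `y² = x³ + ax`, `a ∈ {−1, −25, −1156, −36}`, for algebraic
`x₀, y₀, y₁` with `y₀ = i·y₁` (poles `Q = (−x₀, y₀) = [i](x₀, y₁)`, `P = (x₀, y₁)`), EVERY path `β` on `E^w(x₀)` and
`γ = [−i]^w β` on `[0, 1]` (so `β = [i]^w γ`: `γ = ε₁^w`, `β = ε₂^w`) with `x∘γ = r` real `> −x₀` on `[0, 1]` and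
`r(0) = r(1)`: `(E^w(−x₀), ξ_Q, γ) + (E^w(x₀), ξ_P, β) ∈ ⟨(R1)–(R5)⟩_ℚ̄` and `ξ_Q(γ) + ξ_P(β) = 0`. -/
theorem corpus_xi_loops {a : ℂ} (ha : a = -1 ∨ a = -25 ∨ a = -1156 ∨ a = -36) {y₀ y₁ : ℂ}
    (hx₀ : IsAlgebraic ℚ x₀) (hy₀ : IsAlgebraic ℚ y₀) (hy₁ : IsAlgebraic ℚ y₁) (hy : y₀ + -I * y₁ = 0)
    {β : CurvePath EW[a, 0, x₀]} {γ : CurvePath EW[a, 0, -x₀]}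
    (hγ : ∀ t ∈ Icc (0 : ℝ) 1, γ.toFun t = ![-β.toFun t 0, -I * β.toFun t 1, -β.toFun t 2])
    {xr : ℝ} (hxr : x₀ = xr) {r : ℝ → ℝ} (hr : ∀ t ∈ Icc (0 : ℝ) 1, γ.toFun t 0 = (r t : ℂ))
    (hpos : ∀ t ∈ Icc (0 : ℝ) 1, -xr < r t) (hcl : r 0 = r 1) :
    InSpanRel (Sy[EW[a, 0, -x₀], corpus_smoothEW ha hx₀.neg, ξ[a, 0, y₀], corpus_xi ha hy₀, γ] +
        Sy[EW[a, 0, x₀], corpus_smoothEW ha hx₀, ξ[a, 0, y₁], corpus_xi ha hy₁, β]) ∧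
      Pe[EW[a, 0, -x₀], corpus_smoothEW ha hx₀.neg, ξ[a, 0, y₀], corpus_xi ha hy₀, γ] +
        Pe[EW[a, 0, x₀], corpus_smoothEW ha hx₀, ξ[a, 0, y₁], corpus_xi ha hy₁, β] = 0 :=
  xi_img2_loop_derivation neg_I_sq' _ _ (disc_ne_zero_left (corpus_a ha).2) hx₀ hy _ _
    (corpus_xi ha ((isAlgebraic_of_sq_eq_neg_one neg_I_sq').mul hy₁)) hγ hxr hr hpos hcl

/-! ### The real oval over the 2-torsion interval `[e₁, e₂]` (kz1p's cycle `ε₁`) -/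

/-- **The real oval of `E_{A,B}(ℝ)` over `[e₁, e₂]` as a `C¹` loop.**  Let `x³ + Ax + B = (x − e₁)(x − e₂)(x − e₃)`
with real `e₁ < e₂ < e₃` and `e₁ ∈ ℚ̄`.  Then `X = (e₁+e₂)/2 + (e₁−e₂)/2 · cos 2πt`, `Y` with `Y² = X³ + AX + B`,
`Y ≥ 0` for `t ≤ ½` and `Y ≤ 0` for `t ≥ ½` (explicitly `Y = (e₂−e₁)/2 · sin 2πt · √(e₃ − X)`), is a closed `C¹` path
`δ = (X, Y)` on `E_{A,B}` based at the 2-torsion point `(e₁, 0)`, through `(e₂, 0)` at `t = ½`, with `X ∈ [e₁, e₂]`: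
the compact component of `E_{A,B}(ℝ)` traversed once, upper half-plane sheet first (`x` increasing there).  The case
`σ = 1`, `η = 1`, `ε = −1` of `G2SDerivation.exists_weierOval`. -/
theorem exists_realOval {Ar Br e₁ e₂ e₃ : ℝ} (hA : A = Ar) (hB : B = Br)
    (hfac : ∀ X : ℝ, X ^ 3 + Ar * X + Br = (X - e₁) * (X - e₂) * (X - e₃))
    (h₁₂ : e₁ < e₂) (h₂₃ : e₂ < e₃) (he₁ : IsAlgebraic ℚ (e₁ : ℂ)) :
    ∃ (X Y : ℝ → ℝ) (δ : CurvePath (weierCurve A B)),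
      (∀ t, δ.toFun t = ![(X t : ℂ), (Y t : ℂ)]) ∧
      (∀ t, X t = (e₁ + e₂) / 2 + (e₁ - e₂) / 2 * Real.cos (2 * Real.pi * t)) ∧
      (∀ t, Y t ^ 2 = X t ^ 3 + Ar * X t + Br) ∧
      (X 0 = e₁ ∧ Y 0 = 0) ∧ (X 1 = e₁ ∧ Y 1 = 0) ∧ (X (1 / 2) = e₂ ∧ Y (1 / 2) = 0) ∧
      (∀ t, X t ∈ Icc e₁ e₂) ∧
      ∀ t ∈ Icc (0 : ℝ) 1, (t ≤ 1 / 2 → 0 ≤ Y t) ∧ (1 / 2 ≤ t → Y t ≤ 0) := by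
  obtain ⟨X, Y, δ, -, -, hδ, hX, -, h0, h1, hh, hXb, hYsq, hsh⟩ :=
    exists_weierOval (η := 1) (σ := 1) (ε := -1) hA hB hfac (Or.inl rfl) (by norm_num) (Or.inr rfl)
      (fun X hX => by
        rw [Set.uIcc_of_le h₁₂.le] at hX
        linarith [hX.2])
      he₁
  refine ⟨X, Y, δ, fun t => by rw [hδ t, one_mul], hX, fun t => by rw [← hYsq t, one_mul], h0, h1, hh,
    fun t => by rw [← Set.uIcc_of_le h₁₂.le]; exact hXb t, fun t ht => ?_⟩
  have hk : (0 : ℝ) < (e₂ - e₁) / 2 := by linarith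
  obtain ⟨ha, hb⟩ := hsh t ht
  refine ⟨fun h => ?_, fun h => ?_⟩
  · have h' : (e₂ - e₁) / 2 * 0 ≤ (e₂ - e₁) / 2 * Y t := by linarith [ha h]
    exact le_of_mul_le_mul_left h' hk
  · have h' : (e₂ - e₁) / 2 * Y t ≤ (e₂ - e₁) / 2 * 0 := by linarith [hb h]
    exact le_of_mul_le_mul_left h' hk

end Summit.KontsevichZagierPeriods.KzOnePeriods.XiDerivation

end
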